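import Summits.CriticalPhenomena.PercolationContinuityZ3.Theorems.PercNearOneGluingAdditiveGluingSandwichLemmaU
import HarnessLib

/-!
# A LOCALISED sandwich extension of the van den Berg–Häggström–Kahn inequality — I: Lemma U with an
# increasing observer factor

Crux `PercNearOneGluing.AdditiveGluing` (stmt-CriticalPhenomena-4576), line `peel`, pair step (deep seat d2); lands with
`--supports stmt-CriticalPhenomena-4576`.  No new definitions, no named facts.  Continues seat k41's series
(`…SandwichLemmaU.lean`, `…SandwichCoreS.lean`, `…SandwichLemma3.lean`: Lemma U, Theorem S, Corollary H) with the sandwich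
function multiplied by an INCREASING factor `ψ(C_o) ∈ [0,1]` of the observer's cluster:
  `g_ψ^(T)(ω) = ψ(C_o) · (1{s ↔ o} + 1{s ↮ o} · h(C_o) · 1{o ↮ T})`
(inside `U`: `ψ (rC U o ω) * (if (openGraph (ω ∩ edgesIn U)).Reachable s o then 1 else h (rC U o ω) * ind (rD U o T) ω)`),
`h : Set (Sym2 V) → [0,1]` arbitrary.  Item evidence `PairStepMath-d2.md` §8.4/§8.9 ("Cor H⁺"): with `ψ = 1_𝒰` this is the localisation of
the sandwich function to an up-set `𝒰` of observer clusters; numerically the whole of Theorem S survives (0/1 248), and its base case is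

* `lemmaU_loc` (**Lemma U, localised**): for `F ≥ 0` increasing, `ψ ≥ 0` increasing and `h ≤ 1`,
  `E[F(C_s)] · E[g_ψ^(∅)] ≤ E[F(C_s) g_ψ^(∅)]`.  Proof: `g_ψ^(∅) = ψ(C_o) − k`, `k = ψ(C_o)(1 − h(C_o)) 1{s ↮ o} ≥ 0`; given `C_o = W`
  with `s ↮ o`, `C_s` is the cluster of `s` off `W̄` (BHK's coupling `sum_cond_cluster`), whose `F`-mean is at most `E[F]`, so
  `E[F k] ≤ E[F] E[k]`; and `E[F ψ(C_o)] ≥ E[F] E[ψ(C_o)]` is Harris.  (`ψ ≡ 1` is `lemmaU`.)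
* `lemmaU_loc_restrict`: the same inside `U` (marginalisation `sum_weight_inter`).
* `sandL_nonneg`, `sandL_le_one`, `sandL_antitone`, `sandL_empty`, `sandL_diff_meeting`, `sandL_restrict`: the bounds, the antitonicity in `T`
  and BHK's restriction identity (6) for `g_ψ^(T)` (from the `ψ ≡ 1` versions `sand_*` and `rC_restrict` for the observer).
Part II (`…SandwichLocCoreS.lean`) runs BHK's induction with these in place of `lemmaU_restrict` / `sand_*`.
-/

noncomputable section

open MeasureTheory unitInterval
open Literature.Probability.LatticeModels (prodBernoulli)
open Literature.Probability.Percolation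
open Literature.Probability.Percolation.BHK2006

namespace Summit.CriticalPhenomena.PercolationContinuityZ3.Theorems

namespace SandwichK41

open scoped Classical
open DecisionTree (ind ind_of_mem ind_of_not_mem ind_nonneg)

variable {V : Type*} [Fintype V]

/-! ### Lemma U with an increasing observer factor -/

/-- **Lemma U, localised.** For `F ≥ 0` increasing, `ψ ≥ 0` increasing and `h ≤ 1`,
`E[F(C_s)] · E[ψ(C_o) g₀] ≤ E[F(C_s) ψ(C_o) g₀]` with `g₀ = 1{s ↔ o} + 1{s ↮ o} h(C_o)`: write `ψ(C_o) g₀ = ψ(C_o) − k`,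
`k = ψ(C_o)(1 − h(C_o)) 1{s ↮ o}`; conditionally on `C_o = W` with `s ↮ o`, `C_s` is the cluster of `s` off `W̄`, whose `F`-mean is at most
`E[F(C_s)]` (so `E[F k] ≤ E[F] E[k]`), and `E[F(C_s) ψ(C_o)] ≥ E[F] E[ψ(C_o)]` by Harris.
[folklore; cite: VandenbergHaggstromKahn2005, §1 p. 8 (coupling), p. 6 (Harris)] -/
theorem lemmaU_loc (w : Sym2 V → ℝ) (hw0 : ∀ e, 0 ≤ w e) (hw1 : ∀ e, w e ≤ 1)
    (hm : ∑ ω, weight w ω = 1) (s o : V) (F : Set (Sym2 V) → ℝ) (hF : Monotone F) (hF0 : ∀ C, 0 ≤ F C)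
    (ψ : Set (Sym2 V) → ℝ) (hψ : Monotone ψ) (hψ0 : ∀ C, 0 ≤ ψ C)
    (h : Set (Sym2 V) → ℝ) (h1 : ∀ C, h C ≤ 1) :
    (∑ ω, weight w ω * F (openEdgeCluster ω s)) *
        (∑ ω, weight w ω * (ψ (openEdgeCluster ω o) *
          (if (openGraph ω).Reachable s o then (1 : ℝ) else h (openEdgeCluster ω o)))) ≤
      ∑ ω, weight w ω * (F (openEdgeCluster ω s) * (ψ (openEdgeCluster ω o) *
          (if (openGraph ω).Reachable s o then (1 : ℝ) else h (openEdgeCluster ω o)))) := by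
  set g : Set (Sym2 V) → ℝ := fun ω => ψ (openEdgeCluster ω o) *
    (if (openGraph ω).Reachable s o then (1 : ℝ) else h (openEdgeCluster ω o)) with hg
  show (∑ ω, weight w ω * F (openEdgeCluster ω s)) * (∑ ω, weight w ω * g ω) ≤
      ∑ ω, weight w ω * (F (openEdgeCluster ω s) * g ω)
  set D : Set (Set (Sym2 V)) := {ω | ¬ (openGraph ω).Reachable o s} with hD
  have hDiff : ∀ ω, ω ∈ D ↔ ¬ (openGraph ω).Reachable o s := fun ω => Iff.rfl
  set EF := ∑ ω, weight w ω * F (openEdgeCluster ω s) with hEF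
  set Ψ : Set (Sym2 V) → ℝ := fun ω => ψ (openEdgeCluster ω o) with hΨ
  -- `g = Ψ - k` with `k = ψ(C_o) (1 - h(C_o)) 1_D`
  set k : Set (Sym2 V) → ℝ := fun ω => ψ (openEdgeCluster ω o) * (1 - h (openEdgeCluster ω o)) * ind D ω
    with hk
  have hgk : ∀ ω, g ω = Ψ ω - k ω := by
    intro ω
    simp only [hk, hg, hΨ]
    by_cases hr : (openGraph ω).Reachable s o
    · rw [if_pos hr, ind_of_not_mem (show ω ∉ D from fun hω => hω hr.symm)]; ring
    · rw [if_neg hr, ind_of_mem (show ω ∈ D from fun hω => hr hω.symm)]; ring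
  -- conditioning on `C_o`
  have hcond := sum_cond_cluster w hm o s (fun Co Cs => ψ Co * (1 - h Co) * F Cs) hDiff
  have hle : ∀ ω, (∑ η, weight w η * (ψ (openEdgeCluster ω o) * (1 - h (openEdgeCluster ω o)) *
      F (openEdgeCluster (η \ {e | ∃ v ∈ e, v = o ∨ ∃ e' ∈ openEdgeCluster ω o, v ∈ e'}) s))) * ind D ω ≤
      ψ (openEdgeCluster ω o) * (1 - h (openEdgeCluster ω o)) * EF * ind D ω := by
    intro ω
    refine mul_le_mul_of_nonneg_right ?_ (ind_nonneg _ _)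
    have : ∑ η, weight w η * (ψ (openEdgeCluster ω o) * (1 - h (openEdgeCluster ω o)) *
        F (openEdgeCluster (η \ {e | ∃ v ∈ e, v = o ∨ ∃ e' ∈ openEdgeCluster ω o, v ∈ e'}) s)) =
        ψ (openEdgeCluster ω o) * (1 - h (openEdgeCluster ω o)) * ∑ η, weight w η * F (openEdgeCluster
          (η \ {e | ∃ v ∈ e, v = o ∨ ∃ e' ∈ openEdgeCluster ω o, v ∈ e'}) s) := by
      rw [Finset.mul_sum]
      exact Finset.sum_congr rfl fun η _ => by ring
    rw [this]
    refine mul_le_mul_of_nonneg_left ?_ (mul_nonneg (hψ0 _) (sub_nonneg.2 (h1 _)))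
    exact Finset.sum_le_sum fun η _ => mul_le_mul_of_nonneg_left
      (hF (openEdgeCluster_mono Set.sdiff_subset s)) (weight_nonneg hw0 hw1 η)
  have hFk : ∑ ω, weight w ω * (F (openEdgeCluster ω s) * k ω) ≤ EF * ∑ ω, weight w ω * k ω := by
    have e1 : ∑ ω, weight w ω * (F (openEdgeCluster ω s) * k ω) =
        ∑ ω, weight w ω * (ψ (openEdgeCluster ω o) * (1 - h (openEdgeCluster ω o)) *
          F (openEdgeCluster ω s) * ind D ω) :=
      Finset.sum_congr rfl fun ω _ => by simp only [hk]; ring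
    have e2 : EF * ∑ ω, weight w ω * k ω =
        ∑ ω, weight w ω * (ψ (openEdgeCluster ω o) * (1 - h (openEdgeCluster ω o)) * EF * ind D ω) := by
      rw [Finset.mul_sum]
      exact Finset.sum_congr rfl fun ω _ => by simp only [hk]; ring
    rw [e1, hcond, e2]
    exact Finset.sum_le_sum fun ω _ => mul_le_mul_of_nonneg_left (hle ω) (weight_nonneg hw0 hw1 ω)
  -- Harris for `F(C_s)` and `ψ(C_o)`
  have hFm : Monotone fun ω : Set (Sym2 V) => F (openEdgeCluster ω s) :=
    fun a b hab => hF (openEdgeCluster_mono hab s)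
  have hΨm : Monotone Ψ := fun a b hab => hψ (openEdgeCluster_mono hab o)
  have hH : EF * (∑ ω, weight w ω * Ψ ω) ≤ ∑ ω, weight w ω * (F (openEdgeCluster ω s) * Ψ ω) := by
    have := harris hw0 hw1 (fun ω => hF0 _) (fun ω => hψ0 _) hFm hΨm
    rwa [hm, one_mul] at this
  -- assemble
  have e3 : ∑ ω, weight w ω * g ω = (∑ ω, weight w ω * Ψ ω) - ∑ ω, weight w ω * k ω := by
    have := sum_affine w g Ψ k k k 1 (-1) 0 0 (fun ω => by rw [hgk]; ring)
    rw [this]; ring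
  have e4 : ∑ ω, weight w ω * (F (openEdgeCluster ω s) * g ω) =
      (∑ ω, weight w ω * (F (openEdgeCluster ω s) * Ψ ω)) - ∑ ω, weight w ω * (F (openEdgeCluster ω s) * k ω) := by
    have := sum_affine w (fun ω => F (openEdgeCluster ω s) * g ω)
      (fun ω => F (openEdgeCluster ω s) * Ψ ω) (fun ω => F (openEdgeCluster ω s) * k ω) k k 1 (-1) 0 0
      (fun ω => by rw [hgk]; ring)
    rw [this]; ring
  rw [e3, e4]
  nlinarith [hFk, hH]

/-- **Localised Lemma U for the model restricted to `U`** (marginalisation of `lemmaU_loc`). [folklore] -/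
theorem lemmaU_loc_restrict (w : Sym2 V → ℝ) (hw0 : ∀ e, 0 ≤ w e) (hw1 : ∀ e, w e ≤ 1)
    (hm : ∑ ω, weight w ω = 1) (U : Finset V) (s o : V) (F : Set (Sym2 V) → ℝ) (hF : Monotone F)
    (hF0 : ∀ C, 0 ≤ F C) (ψ : Set (Sym2 V) → ℝ) (hψ : Monotone ψ) (hψ0 : ∀ C, 0 ≤ ψ C)
    (h : Set (Sym2 V) → ℝ) (h1 : ∀ C, h C ≤ 1) :
    (∑ ω, weight w ω * F (rC U s ω)) *
        (∑ ω, weight w ω * (ψ (rC U o ω) *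
          (if (openGraph (ω ∩ edgesIn U)).Reachable s o then (1 : ℝ) else h (rC U o ω)))) ≤
      ∑ ω, weight w ω * (F (rC U s ω) * (ψ (rC U o ω) *
          (if (openGraph (ω ∩ edgesIn U)).Reachable s o then (1 : ℝ) else h (rC U o ω)))) := by
  set w' : Sym2 V → ℝ := fun e => if e ∈ edgesIn U then w e else 0 with hw'
  set g : Set (Sym2 V) → ℝ := fun ω => ψ (openEdgeCluster ω o) *
    (if (openGraph ω).Reachable s o then (1 : ℝ) else h (openEdgeCluster ω o)) with hg
  have hgU : ∀ ω, ψ (rC U o ω) * (if (openGraph (ω ∩ edgesIn U)).Reachable s o then (1 : ℝ) else h (rC U o ω)) =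
      g (ω ∩ edgesIn U) := fun ω => rfl
  simp_rw [hgU]
  have e1 : ∑ ω, weight w ω * F (rC U s ω) = ∑ ω, weight w' ω * F (openEdgeCluster ω s) :=
    sum_weight_inter w hw0 hw1 (edgesIn U) fun ω => F (openEdgeCluster ω s)
  have e2 : ∑ ω, weight w ω * g (ω ∩ edgesIn U) = ∑ ω, weight w' ω * g ω :=
    sum_weight_inter w hw0 hw1 (edgesIn U) g
  have e3 : ∑ ω, weight w ω * (F (rC U s ω) * g (ω ∩ edgesIn U)) =
      ∑ ω, weight w' ω * (F (openEdgeCluster ω s) * g ω) :=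
    sum_weight_inter w hw0 hw1 (edgesIn U) fun ω => F (openEdgeCluster ω s) * g ω
  have hm' : ∑ ω, weight w' ω = 1 := by
    have := sum_weight_inter w hw0 hw1 (edgesIn U) fun _ => (1 : ℝ)
    simp only [mul_one] at this
    rw [← this, hm]
  rw [e1, e2, e3]
  exact lemmaU_loc w' (restrictWeight_nonneg hw0 _) (restrictWeight_le_one hw1 _) hm' s o F hF hF0 ψ hψ hψ0 h h1

/-! ### The localised sandwich function inside `U` -/

/-- `0 ≤ g_ψ^(T)` (for `0 ≤ ψ`, `0 ≤ h`). [folklore] -/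
theorem sandL_nonneg (U : Finset V) (s o : V) {ψ : Set (Sym2 V) → ℝ} (hψ0 : ∀ C, 0 ≤ ψ C)
    {h : Set (Sym2 V) → ℝ} (h0 : ∀ C, 0 ≤ h C) (T : Set V) (ω : Set (Sym2 V)) :
    0 ≤ ψ (rC U o ω) * (if (openGraph (ω ∩ edgesIn U)).Reachable s o then (1 : ℝ)
      else h (rC U o ω) * ind (rD U o T) ω) :=
  mul_nonneg (hψ0 _) (sand_nonneg U s o h0 T ω)

/-- `g_ψ^(T) ≤ 1` (for `ψ ≤ 1`, `0 ≤ h ≤ 1`). [folklore] -/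
theorem sandL_le_one (U : Finset V) (s o : V) {ψ : Set (Sym2 V) → ℝ} (hψ1 : ∀ C, ψ C ≤ 1)
    {h : Set (Sym2 V) → ℝ} (h0 : ∀ C, 0 ≤ h C) (h1 : ∀ C, h C ≤ 1) (T : Set V) (ω : Set (Sym2 V)) :
    ψ (rC U o ω) * (if (openGraph (ω ∩ edgesIn U)).Reachable s o then (1 : ℝ)
      else h (rC U o ω) * ind (rD U o T) ω) ≤ 1 :=
  mul_le_one₀ (hψ1 _) (sand_nonneg U s o h0 T ω) (sand_le_one U s o h1 T ω)

/-- `g_ψ^(T)` is antitone in the constraint set `T` (for `0 ≤ ψ`, `0 ≤ h`). [folklore] -/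
theorem sandL_antitone (U : Finset V) (s o : V) {ψ : Set (Sym2 V) → ℝ} (hψ0 : ∀ C, 0 ≤ ψ C)
    {h : Set (Sym2 V) → ℝ} (h0 : ∀ C, 0 ≤ h C) {T T' : Set V} (hTT' : T ⊆ T') (ω : Set (Sym2 V)) :
    ψ (rC U o ω) * (if (openGraph (ω ∩ edgesIn U)).Reachable s o then (1 : ℝ)
      else h (rC U o ω) * ind (rD U o T') ω) ≤
    ψ (rC U o ω) * (if (openGraph (ω ∩ edgesIn U)).Reachable s o then (1 : ℝ)
      else h (rC U o ω) * ind (rD U o T) ω) :=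
  mul_le_mul_of_nonneg_left (sand_antitone U s o h0 hTT' ω) (hψ0 _)

/-- With the empty constraint set, `g_ψ^(∅) = ψ(C_o) g₀` inside `U`. [folklore] -/
theorem sandL_empty (U : Finset V) (s o : V) (ψ h : Set (Sym2 V) → ℝ) (ω : Set (Sym2 V)) :
    ψ (rC U o ω) * (if (openGraph (ω ∩ edgesIn U)).Reachable s o then (1 : ℝ)
      else h (rC U o ω) * ind (rD U o (∅ : Set V)) ω) =
    ψ (rC U o ω) * (if (openGraph (ω ∩ edgesIn U)).Reachable s o then (1 : ℝ) else h (rC U o ω)) := by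
  rw [sand_empty U s o h ω]

/-- The localised sandwich function of `G[U ∖ Z]` does not depend on the pairs meeting `Z`. [folklore] -/
theorem sandL_diff_meeting (U Z : Finset V) (s o : V) (ψ h : Set (Sym2 V) → ℝ) (T : Set V)
    (η : Set (Sym2 V)) :
    ψ (rC (U \ Z) o (η \ meeting Z)) *
        (if (openGraph ((η \ meeting Z) ∩ edgesIn (U \ Z))).Reachable s o then (1 : ℝ)
          else h (rC (U \ Z) o (η \ meeting Z)) * ind (rD (U \ Z) o T) (η \ meeting Z)) =
    ψ (rC (U \ Z) o η) * (if (openGraph (η ∩ edgesIn (U \ Z))).Reachable s o then (1 : ℝ)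
      else h (rC (U \ Z) o η) * ind (rD (U \ Z) o T) η) := by
  rw [sand_diff_meeting U Z s o h T η, rC_diff_meeting]

/-- **BHK's restriction for the localised sandwich function** (identity (6) for the observer's cluster, with the factor
`ψ(C_o^U) = ψ(C_o^{U∖Z})` on the relevant event). [cite: VandenbergHaggstromKahn2005, §1 p. 4, identity (6)] -/
theorem sandL_restrict {U Z : Finset V} (hZU : Z ⊆ U) {s o : V} (hs : s ∉ Z) (ho : o ∉ Z)
    (ψ h : Set (Sym2 V) → ℝ) {W : Set V} (hZW : (↑Z : Set V) ⊆ W) {ω : Set (Sym2 V)}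
    (hS : ∀ n ∈ rS U Z ω, ¬ (openGraph (ω ∩ edgesIn (U \ Z))).Reachable s n) :
    ψ (rC U o ω) * (if (openGraph (ω ∩ edgesIn U)).Reachable s o then (1 : ℝ)
      else h (rC U o ω) * ind (rD U o W) ω) =
    ψ (rC (U \ Z) o ω) * (if (openGraph (ω ∩ edgesIn (U \ Z))).Reachable s o then (1 : ℝ)
      else h (rC (U \ Z) o ω) * ind (rD (U \ Z) o ((W \ ↑Z) ∪ rS U Z ω)) ω) := by
  rw [sand_restrict hZU hs ho h hZW hS]
  by_cases hr : (openGraph (ω ∩ edgesIn (U \ Z))).Reachable s o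
  · -- `s ↔ o` in `G[U ∖ Z]`: the observer's cluster is the source's, and BHK's restriction applies to it
    have hSo : ∀ n ∈ rS U Z ω, ¬ (openGraph (ω ∩ edgesIn (U \ Z))).Reachable o n :=
      fun n hn hon => hS n hn (hr.trans hon)
    rw [rC_restrict ho hSo]
  · rw [if_neg hr]
    by_cases hω : ω ∈ rD (U \ Z) o ((W \ ↑Z) ∪ rS U Z ω)
    · have hSo : ∀ n ∈ rS U Z ω, ¬ (openGraph (ω ∩ edgesIn (U \ Z))).Reachable o n :=
        fun n hn => hω n (Or.inr hn)
      rw [rC_restrict ho hSo]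
    · rw [ind_of_not_mem hω, mul_zero, mul_zero, mul_zero]

end SandwichK41

end Summit.CriticalPhenomena.PercolationContinuityZ3.Theorems
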